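import Summits.CriticalPhenomena.PercolationContinuityZ3.Theorems.PercNearOneGluingNoHeavyLowerTailSahiE3Cylinder
import Mathlib.Tactic.Linarith
import Mathlib.Tactic.Ring
import HarnessLib

/-!
# `NoHeavyLowerTail` (stmt-CriticalPhenomena-4575) — Sahi `E₃ ≥ 0` for a BLOCK event from a finite certificate on the block
# (the transfer principle behind the "(PU) programme" for Richards' inequality)

Support file (factory seat prim-ineq-gen-8, gen 3; `--supports stmt-CriticalPhenomena-4575`).  No definitions, no named facts, no sorries.

Setting: the weighted cube (`DecisionTree.ED`, `wtW`) on disjoint coordinate sets `B ∪ D` ("block" and "rest"), coordinate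
probabilities `p ∈ [0,1]`; `u` a function of the block coordinates only (below: `S ↦ u (S ∩ B)`), `g, h` arbitrary monotone
nonnegative functions of the whole configuration.  Sahi's third functional / Richards' conjugate cumulant is
`E₃(u,g,h) = 2E[ugh] + Eu·Eg·Eh − Eu·E[gh] − Eg·E[uh] − Eh·E[ug]` (Sahi 2008 Conj. 5 = Richards 2004: `E₃ ≥ 0` for monotone
nonnegative functions; open even on `{0,1}^k`).

THEOREM (`sahiE3_block_nonneg_of_certificate`).  Suppose `π : Finset ι → ℝ`, `π ≥ 0`, is a CERTIFICATE for `u` on the block,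
i.e. with `ū := E_B u`:
 (i)  for every monotone nonnegative `α` on the block:  `E_B[(2u − ū − π)·α] ≥ 0`;
 (ii) for all monotone nonnegative `α, β` on the block:  `E_B[π·α·β] + ū·E_Bα·E_Bβ − E_B[uα]·E_Bβ − E_Bα·E_B[uβ] ≥ 0`.
Then `E₃(u(· ∩ B), g, h) ≥ 0` on the cube `B ∪ D` for ALL monotone nonnegative `g, h` — whatever the rest `D` and its
probabilities.  Proof (the block identity of the seat's memo FINDING-gen3-PU §C): with `G(s) := E_D[g(s∪·)h(s∪·)]`,
`G₁(s) := E_D g(s∪·)`, `H₁(s) := E_D h(s∪·)` (monotone nonnegative in `s`; `G ≥ G₁H₁` by Harris on `D`),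
`E₃ = E_B[(2u−ū−π)G] + E_B[π(G − G₁H₁)] + {E_B[πG₁H₁] + ūE_BG₁·E_BH₁ − E_B[uG₁]E_BH₁ − E_BG₁·E_B[uH₁]}`, three nonnegative terms.
(i) is "`2u − ū − π` lies in the dual cone of monotone functions", (ii) is "`diag(π) + ū − u⊗1 − 1⊗u` is block-copositive";
by the layer-cake principle it suffices to test indicators of up-sets `α = 1_A`, `β = 1_{A′}` — a FINITE linear system in `π`
("(PU)" of the memo), feasible (exact LP) for every up-set on ≤ 4 block coordinates under the measures tested; `π = u·E_B 1`-type
choices recover the cylinder case (`…SahiE3Cylinder`).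

* `ED_union` — Fubini for the weighted cube on a disjoint union: `E_{B∪D} φ = E_B (s ↦ E_D (T ↦ φ (s ∪ T)))`;
* `ED_nonneg` — nonnegative integrands have nonnegative expectation;
* **`sahiE3_block_nonneg_of_certificate`** — the transfer theorem.
-/

noncomputable section

namespace Summit.CriticalPhenomena.PercolationContinuityZ3.Theorems

open Finset Literature.Probability.Percolation Literature.Probability.Percolation.DecisionTree

variable {ι : Type*} [DecidableEq ι]

/-- **Fubini for the weighted cube on a disjoint union of coordinate sets**:
`E_{B ∪ D} φ = E_B (s ↦ E_D (T ↦ φ (s ∪ T)))` (`B ∩ D = ∅`). [folklore] -/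
theorem ED_union (B D : Finset ι) (hBD : Disjoint B D) (p : ι → ℝ) (φ : Finset ι → ℝ) :
    ED (B ∪ D) p φ = ED B p (fun s => ED D p (fun T => φ (s ∪ T))) := by
  induction B using Finset.induction_on generalizing φ with
  | empty =>
    rw [Finset.empty_union, ED_empty]
    exact ED_congr_sub D p fun T _ => by rw [Finset.empty_union]
  | @insert e B' heB ih =>
    have heD : e ∉ D := fun h => (Finset.disjoint_left.1 hBD (Finset.mem_insert_self e B')) h
    have hB'D : Disjoint B' D := Finset.disjoint_of_subset_left (Finset.subset_insert e B') hBD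
    have heBD : e ∉ B' ∪ D := by
      rw [Finset.mem_union, not_or]; exact ⟨heB, heD⟩
    rw [Finset.insert_union, ED_insert p heBD, ED_insert p heB, ih hB'D φ, ih hB'D (fun S => φ (insert e S))]
    have hins : ∀ s T : Finset ι, insert e (s ∪ T) = insert e s ∪ T := fun s T => by
      rw [Finset.insert_union]
    simp only [hins]

/-- A nonnegative integrand has nonnegative expectation on the weighted cube (`p ∈ [0,1]`). [folklore] -/
theorem ED_nonneg (D : Finset ι) {p : ι → ℝ} (hp0 : ∀ i, 0 ≤ p i) (hp1 : ∀ i, p i ≤ 1)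
    {φ : Finset ι → ℝ} (hφ : ∀ S, S ⊆ D → 0 ≤ φ S) : 0 ≤ ED D p φ := by
  unfold ED
  exact Finset.sum_nonneg fun S hS =>
    mul_nonneg (wtW_nonneg D hp0 hp1 S) (hφ S (Finset.mem_powerset.1 hS))

/-- **Transfer theorem: a block certificate proves Sahi's `E₃ ≥ 0` for the block event against arbitrary monotone functions
on any larger cube.**  On the weighted cube on `B ∪ D` (`B ∩ D = ∅`, `p ∈ [0,1]`), let `u` be evaluated on the block part
`S ∩ B`, let `π ≥ 0` satisfy the certificate conditions (i), (ii) of the file header with `ū = E_B u`, and let `g, h` be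
monotone along `⊆` and nonnegative.  Then
`2E[ugh] + Eu·Eg·Eh − Eu·E[gh] − Eg·E[uh] − Eh·E[ug] ≥ 0`  (all expectations on `B ∪ D`, `u` read as `S ↦ u (S ∩ B)`).
[original; the reduction "(PU)(U) ⇒ Richards for U × anything" of the seat memo FINDING-gen3-PU §C] -/
theorem sahiE3_block_nonneg_of_certificate (B D : Finset ι) (hBD : Disjoint B D) {p : ι → ℝ}
    (hp0 : ∀ i, 0 ≤ p i) (hp1 : ∀ i, p i ≤ 1) (u π : Finset ι → ℝ) (hπ : ∀ s, 0 ≤ π s)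
    (hcert1 : ∀ α : Finset ι → ℝ, (∀ ⦃s t : Finset ι⦄, s ⊆ t → α s ≤ α t) → (∀ s, 0 ≤ α s) →
      0 ≤ ED B p (fun s => (2 * u s - ED B p u - π s) * α s))
    (hcert2 : ∀ α β : Finset ι → ℝ, (∀ ⦃s t : Finset ι⦄, s ⊆ t → α s ≤ α t) → (∀ s, 0 ≤ α s) →
      (∀ ⦃s t : Finset ι⦄, s ⊆ t → β s ≤ β t) → (∀ s, 0 ≤ β s) →
      0 ≤ ED B p (fun s => π s * α s * β s) + ED B p u * ED B p α * ED B p β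
            - ED B p (fun s => u s * α s) * ED B p β - ED B p α * ED B p (fun s => u s * β s))
    {g h : Finset ι → ℝ} (hg : ∀ ⦃S T : Finset ι⦄, S ⊆ T → g S ≤ g T) (hh : ∀ ⦃S T : Finset ι⦄, S ⊆ T → h S ≤ h T)
    (hg0 : ∀ S, 0 ≤ g S) (hh0 : ∀ S, 0 ≤ h S) :
    0 ≤ 2 * ED (B ∪ D) p (fun S => u (S ∩ B) * g S * h S)
          + ED (B ∪ D) p (fun S => u (S ∩ B)) * ED (B ∪ D) p g * ED (B ∪ D) p h
          - ED (B ∪ D) p (fun S => u (S ∩ B)) * ED (B ∪ D) p (fun S => g S * h S)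
          - ED (B ∪ D) p g * ED (B ∪ D) p (fun S => u (S ∩ B) * h S)
          - ED (B ∪ D) p h * ED (B ∪ D) p (fun S => u (S ∩ B) * g S) := by
  -- block sections of g, h integrated over the rest
  set G : Finset ι → ℝ := fun s => ED D p (fun T => g (s ∪ T) * h (s ∪ T)) with hG
  set G1 : Finset ι → ℝ := fun s => ED D p (fun T => g (s ∪ T)) with hG1
  set H1 : Finset ι → ℝ := fun s => ED D p (fun T => h (s ∪ T)) with hH1
  -- the block part of a configuration `s ∪ T`, `s ⊆ B`, `T ⊆ D`, is `s`
  have hcap : ∀ s, s ⊆ B → ∀ T, T ⊆ D → (s ∪ T) ∩ B = s := by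
    intro s hs T hT
    ext x
    simp only [Finset.mem_inter, Finset.mem_union]
    constructor
    · rintro ⟨hx | hx, hxB⟩
      · exact hx
      · exact absurd hxB (Finset.disjoint_right.1 hBD (hT hx))
    · intro hx
      exact ⟨Or.inl hx, hs hx⟩
  -- rewrite the five full-cube expectations as block expectations
  have e_ugh : ED (B ∪ D) p (fun S => u (S ∩ B) * g S * h S) = ED B p (fun s => u s * G s) := by
    rw [ED_union B D hBD]
    refine ED_congr_sub B p fun s hs => ?_
    rw [hG, ← ED_mul_left]
    exact ED_congr_sub D p fun T hT => by rw [hcap s hs T hT]; ring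
  have e_u : ED (B ∪ D) p (fun S => u (S ∩ B)) = ED B p u := by
    rw [ED_union B D hBD]
    refine ED_congr_sub B p fun s hs => ?_
    rw [ED_congr_sub D p (fun T hT => by rw [hcap s hs T hT, mul_one] : ∀ T, T ⊆ D → u ((s ∪ T) ∩ B) = u s * 1),
      ED_mul_left, ED_one, mul_one]
  have e_g : ED (B ∪ D) p g = ED B p G1 := by rw [ED_union B D hBD]
  have e_h : ED (B ∪ D) p h = ED B p H1 := by rw [ED_union B D hBD]
  have e_gh : ED (B ∪ D) p (fun S => g S * h S) = ED B p G := by rw [ED_union B D hBD]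
  have e_uh : ED (B ∪ D) p (fun S => u (S ∩ B) * h S) = ED B p (fun s => u s * H1 s) := by
    rw [ED_union B D hBD]
    refine ED_congr_sub B p fun s hs => ?_
    rw [hH1, ← ED_mul_left]
    exact ED_congr_sub D p fun T hT => by rw [hcap s hs T hT]
  have e_ug : ED (B ∪ D) p (fun S => u (S ∩ B) * g S) = ED B p (fun s => u s * G1 s) := by
    rw [ED_union B D hBD]
    refine ED_congr_sub B p fun s hs => ?_
    rw [hG1, ← ED_mul_left]
    exact ED_congr_sub D p fun T hT => by rw [hcap s hs T hT]
  rw [e_ugh, e_u, e_g, e_h, e_gh, e_uh, e_ug]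
  -- monotonicity / nonnegativity of the block sections
  have hGm : ∀ ⦃s t : Finset ι⦄, s ⊆ t → G s ≤ G t := fun s t hst =>
    ED_mono D hp0 hp1 fun T _ =>
      mul_le_mul (hg (Finset.union_subset_union hst (subset_refl T)))
        (hh (Finset.union_subset_union hst (subset_refl T))) (hh0 _) (hg0 _)
  have hG0 : ∀ s, 0 ≤ G s := fun s => ED_nonneg D hp0 hp1 fun T _ => mul_nonneg (hg0 _) (hh0 _)
  have hG1m : ∀ ⦃s t : Finset ι⦄, s ⊆ t → G1 s ≤ G1 t := fun s t hst =>
    ED_mono D hp0 hp1 fun T _ => hg (Finset.union_subset_union hst (subset_refl T))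
  have hG10 : ∀ s, 0 ≤ G1 s := fun s => ED_nonneg D hp0 hp1 fun T _ => hg0 _
  have hH1m : ∀ ⦃s t : Finset ι⦄, s ⊆ t → H1 s ≤ H1 t := fun s t hst =>
    ED_mono D hp0 hp1 fun T _ => hh (Finset.union_subset_union hst (subset_refl T))
  have hH10 : ∀ s, 0 ≤ H1 s := fun s => ED_nonneg D hp0 hp1 fun T _ => hh0 _
  -- Harris on the rest: G s ≥ G1 s * H1 s
  have hGGH : ∀ s, G1 s * H1 s ≤ G s := by
    intro s
    have hgs : ∀ ⦃S T : Finset ι⦄, S ⊆ T → g (s ∪ S) ≤ g (s ∪ T) :=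
      fun S T hST => hg (Finset.union_subset_union (subset_refl s) hST)
    have hhs : ∀ ⦃S T : Finset ι⦄, S ⊆ T → h (s ∪ S) ≤ h (s ∪ T) :=
      fun S T hST => hh (Finset.union_subset_union (subset_refl s) hST)
    exact ED_mul_ED_le_ED_mul D hp0 hp1 hgs hhs
  -- the three nonnegative terms
  have T1 : 0 ≤ ED B p (fun s => (2 * u s - ED B p u - π s) * G s) := hcert1 G hGm hG0
  have T2 : 0 ≤ ED B p (fun s => π s * (G s - G1 s * H1 s)) :=
    ED_nonneg B hp0 hp1 fun s _ => mul_nonneg (hπ s) (sub_nonneg.2 (hGGH s))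
  have T3 : 0 ≤ ED B p (fun s => π s * G1 s * H1 s) + ED B p u * ED B p G1 * ED B p H1
      - ED B p (fun s => u s * G1 s) * ED B p H1 - ED B p G1 * ED B p (fun s => u s * H1 s) :=
    hcert2 G1 H1 hG1m hG10 hH1m hH10
  -- the identity E₃ = T1 + T2 + T3
  have e1 : ED B p (fun s => (2 * u s - ED B p u - π s) * G s) =
      2 * ED B p (fun s => u s * G s) - ED B p u * ED B p G - ED B p (fun s => π s * G s) := by
    have : (fun s => (2 * u s - ED B p u - π s) * G s) =
        (fun s => 2 * (u s * G s) + ((- ED B p u) * G s + (-1) * (π s * G s))) := funext fun s => by ring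
    rw [this, ED_add, ED_mul_left, ED_add, ED_mul_left, ED_mul_left]
    ring
  have e2 : ED B p (fun s => π s * (G s - G1 s * H1 s)) =
      ED B p (fun s => π s * G s) - ED B p (fun s => π s * G1 s * H1 s) := by
    have : (fun s => π s * (G s - G1 s * H1 s)) =
        (fun s => π s * G s + (-1) * (π s * G1 s * H1 s)) := funext fun s => by ring
    rw [this, ED_add, ED_mul_left]
    ring
  nlinarith [T1, T2, T3, e1, e2]

end Summit.CriticalPhenomena.PercolationContinuityZ3.Theorems

end
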